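import Mathlib
import Literature.Analysis.ODE.SmoothDependence
import Literature.Geometry.Symplectic.LegendrianStabilisationModel
import HarnessLib

/-!
# A Darboux box along a Legendrian arc for a 1-form on `ℝ³`

Topic `Literature/Geometry/Symplectic`; infrastructure (brick **D**, Euclidean layer) for the proof
of the named fact `Literature.Geometry.Symplectic.Gompf1998_addLeftTwists`
(`LegendrianRealisation.lean`; Gompf 1998, §1).  Read in a boundary chart of a Stein domain, the
contact form `α = -d^ℂφ` of the boundary becomes a smooth field of linear functionals on an open
subset of `ℝ³`, and a Legendrian arc of the knot becomes a smooth curve `c` with `α(ċ) = 0`.  This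
file constructs, from such data plus the contact condition at one point, **local coordinates
`Ψ : ℝ³ ⊇ V → U` in which the arc is the `x`-axis and `Ψ^*α = g · (dz - y dx)` with `g > 0`** —
the Darboux chart into which the model stabilisation of `LegendrianStabilisationModel.lean` is
transported.  Everything is **proved**; no named facts are introduced.

## Input (`DarbouxData`)

An open `U ∋ 0`, a field `α : ℝ³ → (ℝ³ →L ℝ)` smooth on `U`, a curve `c` smooth on an interval
around `s₀` with `c s₀ = 0`, `c ∈ U` and `α_{c(s)}(ċ(s)) = 0` there, a vector `u₀ ∈ ker α₀` with
`dα₀(ċ(s₀), u₀) > 0` — `dα(u, v) = Dα(u)(v) - Dα(v)(u)`, Mathlib's normalisation of the exterior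
derivative of a 1-form (`extDeriv_form1_apply`); this is the contact condition in the only form
used — and a vector `r₀` with `α₀(r₀) > 0`.

## Construction (namespace `Literature.Geometry.Symplectic.LegendrianDarboux.DarbouxData`)

* `Y w = α_w(r₀) u₀ - α_w(u₀) r₀` — a Legendrian vector field (`α(Y) = 0`) with
  `Y(0) = α₀(r₀) u₀`; its local `C^∞` flow `fl` (the tree's `exists_contDiffOn_flow`,
  Lang 1995, IV §1);
* **the flow box** `Ψ₀(x, y, z) = φ_y(c(s₀ + x) + z r₀)`: smooth on a good set `V₀ ∋ 0`,
  `∂_yΨ₀ = Y ∘ Ψ₀` (`fderiv_Ψ₀_e1`), `Ψ₀(x, 0, 0) = c(s₀ + x)`, `∂ₓΨ₀ = ċ` on the axis,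
  `∂_zΨ₀(0) = r₀`; `DΨ₀(0) = (ċ(s₀) | Y(0) | r₀)` is invertible (`frame_injective`: apply `α₀`, then
  `dα₀(ċ(s₀), ·)`), so `Ψ₀` is a local diffeomorphism `Φ₀` (inverse function theorem);
* the coefficients `A, B, C` of `Ψ₀^*α = A dx + B dy + C dz` (`coef i = α(∂ᵢΨ₀)`): **`B = 0`**
  (`coef_one`), `A = 0` on the axis, `C(0) = α₀(r₀) > 0`, and the mixed derivative
  **`∂_y A(0) = -α₀(r₀) dα₀(ċ(s₀), u₀)`** (`fderiv_coef_zero_e1`: differentiate `B = 0` along `x`,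
  `A` along `y`, use the symmetry of `D²Ψ₀`);
* `a = -A/C`, so `Ψ₀^*α = C (dz - a dx)`, with **`∂_y a(0) = dα₀(ċ(s₀), u₀) > 0`**; the second
  change of coordinates `Ψ₁(x, y, z) = (x, a, z)`, a local diffeomorphism `Φ₁` (its derivative is
  the shear `shear (Da)`, inverted explicitly by `shearInv`);
* **the Darboux box** `Ψ = Ψ₀ ∘ Ψ₁⁻¹` and `g = C ∘ Ψ₁⁻¹` on the open set `V ∋ 0`
  (`V = Φ₁.target ∩ Φ₁⁻¹(core)`): smooth, injective (`injOn_Ψ`), with injective derivative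
  (`fderiv_Ψ_injective`), `Ψ(V) ⊆ U`, `Ψ(x, 0, 0) = c(s₀ + x)` and `DΨ e₀ = ċ` on the axis, `g > 0`,
  and the normal forms
  - `α_Ψ_fderiv : α_{Ψ w}(DΨ_w v) = g(w) (v₂ - w₁ v₀)` (`Ψ^*α = g (dz - y dx)`),
  - `dα_Ψ_fderiv : dα_{Ψ w}(DΨ u, DΨ v) = g (u₀v₁ - u₁v₀) + Dg(u)(v₂ - w₁v₀) - Dg(v)(u₂ - w₁u₀)`
    (`Ψ^*dα = d(g (dz - y dx))`, Mathlib's naturality `extDeriv_pullback`);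
* `exists_box` — a box `{|wᵢ| < ℓ}` inside `V` whose axis segment satisfies the side conditions.

## References

* H. Geiges, *An Introduction to Contact Topology* (2008), Thm. 2.5.1 (Darboux's theorem) — here
  in the elementary 3-dimensional form "straighten a Legendrian vector field, then take the slope
  as a coordinate", which needs no Moser argument. [folklore]
* S. Lang, *Differential and Riemannian Manifolds* (1995), Ch. IV §1 (smooth local flows; the
  tree's `Literature.Analysis.ODE.SmoothDependence`).
* R. E. Gompf, Ann. of Math. 148 (1998), §1. [Gompf1998]

## Design notes

* The input is a hypothesis structure (`DarbouxData`), instantiated from a Stein domain in the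
  sequel; all sets (`V₀ ⊇ V₁ ⊇ core`, `V`) are explicit so that the sequel can shrink further.
* `import Mathlib`, the tree's ODE file, and `LegendrianStabilisationModel` (only for the
  coordinate extensionality lemma `euclidean_three_ext` of `ℝ³`).
-/

noncomputable section

open Real Set Filter Metric Function
open scoped Topology ContDiff

namespace Literature.Geometry.Symplectic.LegendrianDarboux

open Literature.Geometry.Symplectic.LegendrianModel (euclidean_three_ext)

/-- `ℝ³`. -/
local notation "E3" => EuclideanSpace ℝ (Fin 3)

/-- The antisymmetrised derivative of a field of linear functionals `α` on `ℝ³` (the exterior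
derivative of the 1-form `α` in Mathlib's normalisation: `dα(u, v) = Dα(u)(v) - Dα(v)(u)`).
[folklore] -/
def dα (α : E3 → E3 →L[ℝ] ℝ) (w u v : E3) : ℝ := fderiv ℝ α w u v - fderiv ℝ α w v u

/-- **Input data for the Darboux box**: a smooth 1-form `α` on an open `U ∋ 0` of `ℝ³`, a smooth
Legendrian curve `c` through `0 = c s₀`, a vector `u₀ ∈ ker α₀` with `dα₀(ċ(s₀), u₀) > 0`
(the contact condition in the only form used) and a vector `r₀` with `α₀(r₀) > 0`. [folklore] -/
structure DarbouxData where
  /-- the domain -/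
  U : Set E3
  isOpen_U : IsOpen U
  zero_mem : (0 : E3) ∈ U
  /-- the 1-form -/
  α : E3 → E3 →L[ℝ] ℝ
  α_smooth : ContDiffOn ℝ ∞ α U
  /-- the Legendrian curve and its base parameter -/
  c : ℝ → E3
  s₀ : ℝ
  δ : ℝ
  δ_pos : 0 < δ
  c_smooth : ContDiffOn ℝ ∞ c (Ioo (s₀ - δ) (s₀ + δ))
  c_mem : ∀ s ∈ Ioo (s₀ - δ) (s₀ + δ), c s ∈ U
  c_s₀ : c s₀ = 0
  legendrian : ∀ s ∈ Ioo (s₀ - δ) (s₀ + δ), α (c s) (deriv c s) = 0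
  /-- the Legendrian direction transverse to the curve, and the transverse direction -/
  u₀ : E3
  r₀ : E3
  α_u₀ : α 0 u₀ = 0
  α_r₀ : 0 < α 0 r₀
  twist : 0 < dα α 0 (deriv c s₀) u₀

namespace DarbouxData

variable (D : DarbouxData)

/-! ### The Legendrian vector field `Y = α(r₀) u₀ - α(u₀) r₀` -/

/-- The Legendrian vector field `Y(w) = α_w(r₀) u₀ - α_w(u₀) r₀` (`α(Y) = 0`). [folklore] -/
def Y (w : E3) : E3 := (D.α w D.r₀) • D.u₀ - (D.α w D.u₀) • D.r₀

/-- `α(Y) = 0`. [folklore] -/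
theorem α_Y (w : E3) : D.α w (D.Y w) = 0 := by
  simp only [Y, map_sub, map_smul, smul_eq_mul]; ring

/-- `Y(0) = α₀(r₀) u₀`. [folklore] -/
theorem Y_zero : D.Y 0 = (D.α 0 D.r₀) • D.u₀ := by
  simp [Y, D.α_u₀]

/-- `Y` is smooth on `U`. [folklore] -/
theorem contDiffOn_Y : ContDiffOn ℝ ∞ D.Y D.U :=
  ((D.α_smooth.clm_apply contDiffOn_const).smul contDiffOn_const).sub
    ((D.α_smooth.clm_apply contDiffOn_const).smul contDiffOn_const)

/-! ### The velocity of the curve -/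

/-- The velocity `ċ(s₀)`. [folklore] -/
def c' : E3 := deriv D.c D.s₀

/-- `s₀` lies in the smoothness interval. [folklore] -/
theorem s₀_mem : D.s₀ ∈ Ioo (D.s₀ - D.δ) (D.s₀ + D.δ) := ⟨by linarith [D.δ_pos], by linarith [D.δ_pos]⟩

/-- The smoothness interval is a neighbourhood of `s₀`. [folklore] -/
theorem Ioo_mem_nhds_s₀ : Ioo (D.s₀ - D.δ) (D.s₀ + D.δ) ∈ 𝓝 D.s₀ := isOpen_Ioo.mem_nhds D.s₀_mem

/-- `c` is smooth at the points of the interval. [folklore] -/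
theorem contDiffAt_c {s : ℝ} (hs : s ∈ Ioo (D.s₀ - D.δ) (D.s₀ + D.δ)) : ContDiffAt ℝ ∞ D.c s :=
  D.c_smooth.contDiffAt (isOpen_Ioo.mem_nhds hs)

/-- `c` is differentiable at the points of the interval. [folklore] -/
theorem hasDerivAt_c {s : ℝ} (hs : s ∈ Ioo (D.s₀ - D.δ) (D.s₀ + D.δ)) :
    HasDerivAt D.c (deriv D.c s) s :=
  ((D.contDiffAt_c hs).differentiableAt (by simp)).hasDerivAt

/-- `ċ(s₀) ≠ 0` (since `dα₀(ċ(s₀), u₀) ≠ 0`). [folklore] -/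
theorem c'_ne_zero : D.c' ≠ 0 := fun h => by
  have := D.twist
  simp only [dα, c'] at this h
  rw [h] at this; simp at this

/-- `α₀(ċ(s₀)) = 0`. [folklore] -/
theorem α_c' : D.α 0 D.c' = 0 := by
  have := D.legendrian D.s₀ D.s₀_mem
  rwa [D.c_s₀] at this

/-! ### The frame `(ċ(s₀), Y(0), r₀)` is a basis -/

/-- The linear map `(a, b, c) ↦ a ċ(s₀) + b Y(0) + c r₀`. [folklore] -/
def frame : E3 →L[ℝ] E3 :=
  (EuclideanSpace.proj 0).smulRight D.c' + (EuclideanSpace.proj 1).smulRight (D.Y 0) +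
    (EuclideanSpace.proj 2).smulRight D.r₀

/-- The frame map, evaluated. [folklore] -/
@[simp] theorem frame_apply (v : E3) : D.frame v = v 0 • D.c' + v 1 • D.Y 0 + v 2 • D.r₀ := by
  simp [frame]

/-- The standard basis vectors of `ℝ³`. [folklore] -/
def e (i : Fin 3) : E3 := EuclideanSpace.single i (1 : ℝ)

/-- `eᵢ i = 1`. [folklore] -/
@[simp] theorem e_apply_same (i : Fin 3) : e i i = 1 := by simp [e]

/-- Coordinates of the basis vectors. [folklore] -/
theorem e_apply (i j : Fin 3) : e i j = if j = i then 1 else 0 := by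
  simp [e]

/-- Decomposition of a vector of `ℝ³` in the standard basis. [folklore] -/
theorem eq_sum_smul_e (v : E3) : v = v 0 • e 0 + v 1 • e 1 + v 2 • e 2 := by
  ext i; fin_cases i <;> simp [e]

/-- A continuous linear map on `ℝ³` is determined by its values on the standard basis. [folklore] -/
theorem clm_apply_eq {F : Type*} [NormedAddCommGroup F] [NormedSpace ℝ F] (L : E3 →L[ℝ] F) (v : E3) :
    L v = v 0 • L (e 0) + v 1 • L (e 1) + v 2 • L (e 2) := by
  conv_lhs => rw [eq_sum_smul_e v]
  simp only [map_add, map_smul]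

/-- The frame map is injective: `ċ(s₀), Y(0) = α₀(r₀) u₀, r₀` are linearly independent
(apply `α₀`, then `dα₀(ċ(s₀), ·)`). [folklore] -/
theorem frame_injective : Injective D.frame := by
  intro v w hvw
  have h : D.frame (v - w) = 0 := by rw [map_sub, hvw, sub_self]
  suffices hz : v - w = 0 from sub_eq_zero.1 hz
  set d : E3 := v - w with hd
  rw [frame_apply] at h
  -- apply `α₀`
  have h2 : d 2 = 0 := by
    have := congrArg (D.α 0) h
    simp only [map_add, map_smul, smul_eq_mul, D.α_c', D.α_Y, map_zero, mul_zero, zero_add] at this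
    exact (mul_eq_zero.1 this).resolve_right D.α_r₀.ne'
  rw [h2, zero_smul, add_zero] at h
  -- apply `dα₀(ċ(s₀), ·)`
  have h1 : d 1 = 0 := by
    have := congrArg (fun x : E3 => dα D.α 0 D.c' x) h
    simp only [dα, map_add, map_smul, smul_eq_mul, add_apply, smul_apply, map_zero,
      zero_apply, D.Y_zero] at this
    have ht := D.twist
    simp only [dα, c'] at ht this
    have : d 1 * (D.α 0 D.r₀ * (fderiv ℝ D.α 0 (deriv D.c D.s₀) D.u₀ - fderiv ℝ D.α 0 D.u₀ (deriv D.c D.s₀))) = 0 := by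
      linear_combination this
    exact (mul_eq_zero.1 this).resolve_right (mul_ne_zero D.α_r₀.ne' ht.ne')
  rw [h1, zero_smul, add_zero] at h
  have h0 : d 0 = 0 := (smul_eq_zero.1 h).resolve_right D.c'_ne_zero
  rw [eq_sum_smul_e d, h0, h1, h2]; simp

/-- The frame map as a continuous linear equivalence. [folklore] -/
def frameEquiv : E3 ≃L[ℝ] E3 :=
  (LinearMap.linearEquivOfInjective D.frame.toLinearMap D.frame_injective rfl).toContinuousLinearEquiv

/-- The frame equivalence is the frame map. [folklore] -/
@[simp] theorem frameEquiv_apply (v : E3) : D.frameEquiv v = D.frame v := rfl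

/-- The frame equivalence is the frame map (as continuous linear maps). [folklore] -/
theorem coe_frameEquiv : (D.frameEquiv : E3 →L[ℝ] E3) = D.frame := by
  ext v; rfl

/-! ### The local flow of `Y` -/

/-- A local `C^∞` flow of `Y` near `0` (the data produced by the tree's smooth-dependence
result `Literature.Analysis.ODE.exists_contDiffOn_flow`). [folklore] -/
structure Flow where
  /-- the flow `φ x t` -/
  φ : E3 → ℝ → E3
  /-- radius of initial conditions -/
  r : ℝ
  /-- time of existence -/
  ε : ℝ
  r_pos : 0 < r
  ε_pos : 0 < ε
  φ_zero : ∀ x ∈ ball (0 : E3) r, φ x 0 = x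
  hasDerivAt_φ : ∀ x ∈ ball (0 : E3) r, ∀ t ∈ Ioo (-ε) ε, HasDerivAt (φ x) (D.Y (φ x t)) t
  φ_mem : ∀ x ∈ ball (0 : E3) r, ∀ t ∈ Ioo (-ε) ε, φ x t ∈ D.U
  contDiffOn_φ : ContDiffOn ℝ ∞ (fun p : E3 × ℝ => φ p.1 p.2) (ball (0 : E3) r ×ˢ Ioo (-ε) ε)

/-- A local smooth flow of `Y` exists. [folklore] -/
theorem nonempty_flow : Nonempty D.Flow := by
  obtain ⟨φ, r, hr, ε, hε, h0, hd, hm, hs⟩ :=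
    Literature.Analysis.ODE.exists_contDiffOn_flow (n := (⊤ : ℕ∞)) D.isOpen_U D.contDiffOn_Y le_top
      D.zero_mem
  exact ⟨⟨φ, r, ε, hr, hε, h0, hd, hm, hs⟩⟩

/-- The chosen local flow of `Y`. [folklore] -/
def fl : D.Flow := Classical.choice D.nonempty_flow

/-! ### The flow box `Ψ₀(x, y, z) = φ_y(c(s₀ + x) + z r₀)` -/

/-- The transversal surface `σ(x, z) = c(s₀ + x) + z r₀`. [folklore] -/
def σ (x z : ℝ) : E3 := D.c (D.s₀ + x) + z • D.r₀

/-- **The flow box** `Ψ₀(w) = φ_{w₁}(σ(w₀, w₂))`. [folklore] -/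
def Ψ₀ (w : E3) : E3 := D.fl.φ (D.σ (w 0) (w 2)) (w 1)

/-- The inner map `w ↦ (σ(w₀, w₂), w₁)`. [folklore] -/
def G (w : E3) : E3 × ℝ := (D.σ (w 0) (w 2), w 1)

/-- `Ψ₀` as the composition of the uncurried flow with the inner map. [folklore] -/
theorem Ψ₀_eq (w : E3) : D.Ψ₀ w = (fun p : E3 × ℝ => D.fl.φ p.1 p.2) (D.G w) := rfl

/-- `σ(0, 0) = 0`. [folklore] -/
@[simp] theorem σ_zero : D.σ 0 0 = 0 := by simp [σ, D.c_s₀]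

/-- `G(0) = (0, 0)`. [folklore] -/
@[simp] theorem G_zero : D.G 0 = (0, 0) := by simp [G]

/-- The good set: parameters whose flow data stay in the flow domain and whose curve parameter
stays in the smoothness interval. [folklore] -/
def V₀ : Set E3 :=
  {w | D.G w ∈ ball (0 : E3) D.fl.r ×ˢ Ioo (-D.fl.ε) D.fl.ε ∧ D.s₀ + w 0 ∈ Ioo (D.s₀ - D.δ) (D.s₀ + D.δ)}

/-- `0` lies in the good set. [folklore] -/
theorem zero_mem_V₀ : (0 : E3) ∈ D.V₀ := by
  refine ⟨?_, by simpa using D.s₀_mem⟩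
  rw [G_zero]; exact ⟨mem_ball_self D.fl.r_pos, by simp [D.fl.ε_pos]⟩

/-- The transversal surface is smooth. [folklore] -/
theorem contDiffAt_σ {x : ℝ} (hx : D.s₀ + x ∈ Ioo (D.s₀ - D.δ) (D.s₀ + D.δ)) (z : ℝ) :
    ContDiffAt ℝ ∞ (fun p : ℝ × ℝ => D.σ p.1 p.2) (x, z) := by
  unfold σ
  refine ContDiffAt.add ?_ (contDiffAt_snd.smul contDiffAt_const)
  exact (D.contDiffAt_c hx).comp (x, z) (contDiffAt_const.add contDiffAt_fst)

/-- The inner map is smooth where the curve parameter is good. [folklore] -/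
theorem contDiffAt_G {w : E3} (hw : D.s₀ + w 0 ∈ Ioo (D.s₀ - D.δ) (D.s₀ + D.δ)) :
    ContDiffAt ℝ ∞ D.G w := by
  have h0 : ContDiffAt ℝ ∞ (fun w : E3 => w 0) w :=
    (EuclideanSpace.proj (𝕜 := ℝ) (0 : Fin 3)).contDiff.contDiffAt
  have h1 : ContDiffAt ℝ ∞ (fun w : E3 => w 1) w :=
    (EuclideanSpace.proj (𝕜 := ℝ) (1 : Fin 3)).contDiff.contDiffAt
  have h2 : ContDiffAt ℝ ∞ (fun w : E3 => w 2) w :=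
    (EuclideanSpace.proj (𝕜 := ℝ) (2 : Fin 3)).contDiff.contDiffAt
  exact ((D.contDiffAt_σ hw (w 2)).comp w (h0.prodMk h2)).prodMk h1

/-- The inner map is continuous where the curve parameter is good. [folklore] -/
theorem continuousAt_G {w : E3} (hw : D.s₀ + w 0 ∈ Ioo (D.s₀ - D.δ) (D.s₀ + D.δ)) :
    ContinuousAt D.G w := (D.contDiffAt_G hw).continuousAt

/-- The good set is open. [folklore] -/
theorem isOpen_V₀ : IsOpen D.V₀ := by
  rw [isOpen_iff_mem_nhds]
  intro w hw
  have h2 : {w : E3 | D.s₀ + w 0 ∈ Ioo (D.s₀ - D.δ) (D.s₀ + D.δ)} ∈ 𝓝 w :=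
    (continuous_const.add (EuclideanSpace.proj (𝕜 := ℝ) (0 : Fin 3)).continuous).continuousAt.preimage_mem_nhds
      (isOpen_Ioo.mem_nhds hw.2)
  have h1 : {w : E3 | D.G w ∈ ball (0 : E3) D.fl.r ×ˢ Ioo (-D.fl.ε) D.fl.ε} ∈ 𝓝 w :=
    (D.continuousAt_G hw.2).preimage_mem_nhds ((isOpen_ball.prod isOpen_Ioo).mem_nhds hw.1)
  exact Filter.inter_mem h1 h2

/-- The good set is a neighbourhood of `0`. [folklore] -/
theorem V₀_mem_nhds_zero : D.V₀ ∈ 𝓝 (0 : E3) := D.isOpen_V₀.mem_nhds D.zero_mem_V₀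

/-- `Ψ₀` is smooth on the good set. [folklore] -/
theorem contDiffAt_Ψ₀ {w : E3} (hw : w ∈ D.V₀) : ContDiffAt ℝ ∞ D.Ψ₀ w := by
  have hφ : ContDiffAt ℝ ∞ (fun p : E3 × ℝ => D.fl.φ p.1 p.2) (D.G w) :=
    D.fl.contDiffOn_φ.contDiffAt ((isOpen_ball.prod isOpen_Ioo).mem_nhds hw.1)
  exact hφ.comp w (D.contDiffAt_G hw.2)

/-- `Ψ₀` is smooth on the good set. [folklore] -/
theorem contDiffOn_Ψ₀ : ContDiffOn ℝ ∞ D.Ψ₀ D.V₀ := fun _ hw => (D.contDiffAt_Ψ₀ hw).contDiffWithinAt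

/-- `Ψ₀` is differentiable on the good set. [folklore] -/
theorem differentiableAt_Ψ₀ {w : E3} (hw : w ∈ D.V₀) : DifferentiableAt ℝ D.Ψ₀ w :=
  (D.contDiffAt_Ψ₀ hw).differentiableAt (by simp)

/-- `Ψ₀` maps the good set into `U`. [folklore] -/
theorem Ψ₀_mem_U {w : E3} (hw : w ∈ D.V₀) : D.Ψ₀ w ∈ D.U :=
  D.fl.φ_mem _ hw.1.1 _ hw.1.2

/-! ### Partial derivatives of the flow box -/

/-- **`∂_y Ψ₀ = Y ∘ Ψ₀`** (the flow equation). [folklore] -/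
theorem fderiv_Ψ₀_e1 {w : E3} (hw : w ∈ D.V₀) : fderiv ℝ D.Ψ₀ w (e 1) = D.Y (D.Ψ₀ w) := by
  set γ : ℝ → E3 := fun t => w + (t - w 1) • e 1 with hγ
  have hγd : HasDerivAt γ (e 1) (w 1) := by
    have : HasDerivAt (fun t : ℝ => (t - w 1) • e 1) ((1 : ℝ) • e 1) (w 1) :=
      ((hasDerivAt_id (w 1)).sub_const (w 1)).smul_const (e 1)
    simpa [hγ] using this.const_add w
  have hγw : γ (w 1) = w := by simp [hγ]
  have h1 : HasDerivAt (D.Ψ₀ ∘ γ) (fderiv ℝ D.Ψ₀ w (e 1)) (w 1) := by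
    have hd : HasFDerivAt D.Ψ₀ (fderiv ℝ D.Ψ₀ w) (γ (w 1)) := by
      rw [hγw]; exact (D.differentiableAt_Ψ₀ hw).hasFDerivAt
    exact hd.comp_hasDerivAt (w 1) hγd
  have h2 : D.Ψ₀ ∘ γ = fun t => D.fl.φ (D.σ (w 0) (w 2)) t := by
    funext t
    simp [hγ, Ψ₀, Function.comp, e_apply]
  rw [h2] at h1
  have h3 : HasDerivAt (fun t => D.fl.φ (D.σ (w 0) (w 2)) t) (D.Y (D.Ψ₀ w)) (w 1) :=
    D.fl.hasDerivAt_φ _ hw.1.1 _ hw.1.2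
  exact h1.unique h3

/-- Points of the axis near `0` lie in the good set. [folklore] -/
theorem axis_mem_V₀ : ∀ᶠ x : ℝ in 𝓝 0, (x • e 0 : E3) ∈ D.V₀ := by
  have hc : Continuous fun x : ℝ => (x • e 0 : E3) := continuous_id.smul continuous_const
  have h0 : D.V₀ ∈ 𝓝 ((fun x : ℝ => (x • e 0 : E3)) 0) := by simpa using D.V₀_mem_nhds_zero
  exact hc.continuousAt.preimage_mem_nhds h0

/-- On the axis the flow box is the curve: `Ψ₀(x, 0, 0) = c(s₀ + x)`. [folklore] -/
theorem Ψ₀_axis {x : ℝ} (hx : (x • e 0 : E3) ∈ D.V₀) : D.Ψ₀ (x • e 0) = D.c (D.s₀ + x) := by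
  have h := D.fl.φ_zero _ hx.1.1
  simp only [G] at h
  simpa [Ψ₀, σ, e_apply] using h

/-- **`∂_x Ψ₀ = ċ` along the axis.** [folklore] -/
theorem fderiv_Ψ₀_e0_axis {x : ℝ} (hx : (x • e 0 : E3) ∈ D.V₀) :
    fderiv ℝ D.Ψ₀ (x • e 0) (e 0) = deriv D.c (D.s₀ + x) := by
  set γ : ℝ → E3 := fun t => t • e 0 with hγ
  have hγd : HasDerivAt γ (e 0) x := by
    simpa [hγ] using (hasDerivAt_id x).smul_const (e 0)
  have h1 : HasDerivAt (D.Ψ₀ ∘ γ) (fderiv ℝ D.Ψ₀ (x • e 0) (e 0)) x :=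
    (D.differentiableAt_Ψ₀ hx).hasFDerivAt.comp_hasDerivAt x hγd
  -- near `x`, `Ψ₀ (t e₀) = c (s₀ + t)`
  have hev : (fun t => D.c (D.s₀ + t)) =ᶠ[𝓝 x] (D.Ψ₀ ∘ γ) := by
    have hc : Continuous fun t : ℝ => (t • e 0 : E3) := continuous_id.smul continuous_const
    filter_upwards [hc.continuousAt.preimage_mem_nhds (D.isOpen_V₀.mem_nhds hx)] with t ht
    exact (D.Ψ₀_axis ht).symm
  have hx' : D.s₀ + x ∈ Ioo (D.s₀ - D.δ) (D.s₀ + D.δ) := by simpa [e_apply] using hx.2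
  have h2 : HasDerivAt (fun t => D.c (D.s₀ + t)) (deriv D.c (D.s₀ + x)) x := by
    have h3 : HasDerivAt (fun t => D.c (D.s₀ + t)) ((1 : ℝ) • deriv D.c (D.s₀ + x)) x :=
      HasDerivAt.scomp (g₁ := D.c) (h := fun t => D.s₀ + t) x (D.hasDerivAt_c hx')
        ((hasDerivAt_id' x).const_add D.s₀)
    rwa [one_smul] at h3
  exact (h1.congr_of_eventuallyEq hev).unique h2

/-- `Ψ₀(0, 0, z) = z r₀` near `z = 0`. [folklore] -/
theorem Ψ₀_e2 {z : ℝ} (hz : (z • e 2 : E3) ∈ D.V₀) : D.Ψ₀ (z • e 2) = z • D.r₀ := by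
  have h := D.fl.φ_zero _ hz.1.1
  simp only [G] at h
  simpa [Ψ₀, σ, e_apply, D.c_s₀] using h

/-- **`∂_z Ψ₀(0) = r₀`.** [folklore] -/
theorem fderiv_Ψ₀_e2_zero : fderiv ℝ D.Ψ₀ 0 (e 2) = D.r₀ := by
  set γ : ℝ → E3 := fun t => t • e 2 with hγ
  have hγd : HasDerivAt γ (e 2) 0 := by simpa [hγ] using (hasDerivAt_id (0:ℝ)).smul_const (e 2)
  have h1 : HasDerivAt (D.Ψ₀ ∘ γ) (fderiv ℝ D.Ψ₀ 0 (e 2)) 0 := by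
    have hd : HasFDerivAt D.Ψ₀ (fderiv ℝ D.Ψ₀ 0) (γ 0) := by
      rw [show γ 0 = 0 by simp [hγ]]; exact (D.differentiableAt_Ψ₀ D.zero_mem_V₀).hasFDerivAt
    exact hd.comp_hasDerivAt 0 hγd
  have hev : (fun t : ℝ => t • D.r₀) =ᶠ[𝓝 (0 : ℝ)] (D.Ψ₀ ∘ γ) := by
    have hc : Continuous fun t : ℝ => (t • e 2 : E3) := continuous_id.smul continuous_const
    have h0 : D.V₀ ∈ 𝓝 ((fun t : ℝ => (t • e 2 : E3)) 0) := by simpa using D.V₀_mem_nhds_zero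
    filter_upwards [hc.continuousAt.preimage_mem_nhds h0] with t ht
    exact (D.Ψ₀_e2 ht).symm
  have h2 : HasDerivAt (fun t : ℝ => t • D.r₀) D.r₀ 0 := by
    simpa using (hasDerivAt_id (0:ℝ)).smul_const D.r₀
  exact (h1.congr_of_eventuallyEq hev).unique h2

/-- `Ψ₀(0) = 0`. [folklore] -/
@[simp] theorem Ψ₀_zero : D.Ψ₀ 0 = 0 := by
  have := D.Ψ₀_axis (x := 0) (by simpa using D.zero_mem_V₀)
  simpa [D.c_s₀] using this

/-- **The derivative of the flow box at the origin is the frame map.** [folklore] -/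
theorem fderiv_Ψ₀_zero : fderiv ℝ D.Ψ₀ 0 = D.frame := by
  apply ContinuousLinearMap.ext
  intro v
  rw [clm_apply_eq (fderiv ℝ D.Ψ₀ 0) v, frame_apply]
  have h0 : fderiv ℝ D.Ψ₀ 0 (e 0) = D.c' := by
    have := D.fderiv_Ψ₀_e0_axis (x := 0) (by simpa using D.zero_mem_V₀)
    simpa [c'] using this
  have h1 : fderiv ℝ D.Ψ₀ 0 (e 1) = D.Y 0 := by
    have := D.fderiv_Ψ₀_e1 D.zero_mem_V₀
    rwa [Ψ₀_zero] at this
  rw [h0, h1, D.fderiv_Ψ₀_e2_zero]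

/-- The derivative of `Ψ₀` at `0` is the frame equivalence. [folklore] -/
theorem hasFDerivAt_Ψ₀_zero : HasFDerivAt D.Ψ₀ (D.frameEquiv : E3 →L[ℝ] E3) 0 := by
  rw [coe_frameEquiv, ← fderiv_Ψ₀_zero]
  exact (D.differentiableAt_Ψ₀ D.zero_mem_V₀).hasFDerivAt

/-- **The flow box is a local diffeomorphism at the origin** (inverse function theorem).
[folklore] -/
def Φ₀ : OpenPartialHomeomorph E3 E3 :=
  ContDiffAt.toOpenPartialHomeomorph D.Ψ₀ (D.contDiffAt_Ψ₀ D.zero_mem_V₀) D.hasFDerivAt_Ψ₀_zero (by simp)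

/-- `Φ₀` is `Ψ₀` as a function. [folklore] -/
theorem Φ₀_coe : (D.Φ₀ : E3 → E3) = D.Ψ₀ :=
  ContDiffAt.toOpenPartialHomeomorph_coe _ _ _

/-- `0` lies in the source of `Φ₀`. [folklore] -/
theorem zero_mem_Φ₀_source : (0 : E3) ∈ D.Φ₀.source :=
  ContDiffAt.mem_toOpenPartialHomeomorph_source _ _ _

/-- `Ψ₀` is injective near the origin. [folklore] -/
theorem injOn_Ψ₀ : InjOn D.Ψ₀ D.Φ₀.source := by
  rw [← Φ₀_coe]; exact D.Φ₀.injOn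


/-! ### The coefficients `A = α(∂ₓΨ₀)`, `B = α(∂_yΨ₀) = 0`, `C = α(∂_zΨ₀)` -/

/-- The partial derivative `∂ᵢΨ₀`. [folklore] -/
def P (i : Fin 3) (w : E3) : E3 := fderiv ℝ D.Ψ₀ w (e i)

/-- The coefficient `α_{Ψ₀ w}(∂ᵢ Ψ₀ w)` of the pulled-back form `Ψ₀^* α = A dx + B dy + C dz`.
[folklore] -/
def coef (i : Fin 3) (w : E3) : ℝ := D.α (D.Ψ₀ w) (D.P i w)

/-- `DΨ₀` is smooth on the good set. [folklore] -/
theorem contDiffAt_fderiv_Ψ₀ {w : E3} (hw : w ∈ D.V₀) : ContDiffAt ℝ ∞ (fderiv ℝ D.Ψ₀) w :=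
  (D.contDiffAt_Ψ₀ hw).fderiv_right (m := ∞) (by simp)

/-- The partial derivatives are smooth on the good set. [folklore] -/
theorem contDiffAt_P (i : Fin 3) {w : E3} (hw : w ∈ D.V₀) : ContDiffAt ℝ ∞ (D.P i) w :=
  (D.contDiffAt_fderiv_Ψ₀ hw).clm_apply contDiffAt_const

/-- `α ∘ Ψ₀` is smooth on the good set. [folklore] -/
theorem contDiffAt_α_Ψ₀ {w : E3} (hw : w ∈ D.V₀) : ContDiffAt ℝ ∞ (fun w => D.α (D.Ψ₀ w)) w :=
  (D.α_smooth.contDiffAt (D.isOpen_U.mem_nhds (D.Ψ₀_mem_U hw))).comp w (D.contDiffAt_Ψ₀ hw)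

/-- The coefficients are smooth on the good set. [folklore] -/
theorem contDiffAt_coef (i : Fin 3) {w : E3} (hw : w ∈ D.V₀) : ContDiffAt ℝ ∞ (D.coef i) w :=
  (D.contDiffAt_α_Ψ₀ hw).clm_apply (D.contDiffAt_P i hw)

/-- The coefficients are differentiable on the good set. [folklore] -/
theorem differentiableAt_coef (i : Fin 3) {w : E3} (hw : w ∈ D.V₀) : DifferentiableAt ℝ (D.coef i) w :=
  (D.contDiffAt_coef i hw).differentiableAt (by simp)

/-- **`B = 0`**: the `dy`-coefficient vanishes (`∂_yΨ₀ = Y`, `α(Y) = 0`). [folklore] -/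
theorem coef_one {w : E3} (hw : w ∈ D.V₀) : D.coef 1 w = 0 := by
  simp only [coef, P, D.fderiv_Ψ₀_e1 hw, D.α_Y]

/-- **`A = 0` on the axis** (the curve is Legendrian). [folklore] -/
theorem coef_zero_axis {x : ℝ} (hx : (x • e 0 : E3) ∈ D.V₀) : D.coef 0 (x • e 0) = 0 := by
  have hx' : D.s₀ + x ∈ Ioo (D.s₀ - D.δ) (D.s₀ + D.δ) := by simpa [e_apply] using hx.2
  simp only [coef, P, D.fderiv_Ψ₀_e0_axis hx, D.Ψ₀_axis hx, D.legendrian _ hx']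

/-- `A(0) = 0`. [folklore] -/
@[simp] theorem coef_zero_zero : D.coef 0 0 = 0 := by
  simpa using D.coef_zero_axis (x := 0) (by simpa using D.zero_mem_V₀)

/-- **`C(0) = α₀(r₀) > 0`.** [folklore] -/
theorem coef_two_zero : D.coef 2 0 = D.α 0 D.r₀ := by
  simp only [coef, P, D.fderiv_Ψ₀_e2_zero, Ψ₀_zero]

/-- `C(0) > 0`. [folklore] -/
theorem coef_two_zero_pos : 0 < D.coef 2 0 := by rw [coef_two_zero]; exact D.α_r₀

/-- `∂ₓΨ₀(0) = ċ(s₀)`. [folklore] -/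
@[simp] theorem P_zero_zero : D.P 0 0 = D.c' := by
  have := D.fderiv_Ψ₀_e0_axis (x := 0) (by simpa using D.zero_mem_V₀)
  simpa [P, c'] using this

/-- `∂_yΨ₀(0) = Y(0)`. [folklore] -/
@[simp] theorem P_one_zero : D.P 1 0 = D.Y 0 := by
  have := D.fderiv_Ψ₀_e1 D.zero_mem_V₀
  simpa [P] using this

/-! ### The mixed derivative: `∂_y A(0) = -α₀(r₀) · dα₀(ċ(s₀), u₀)` -/

/-- The derivative of a coefficient: product rule for `w ↦ α_{Ψ₀ w}(∂ᵢΨ₀ w)`. [folklore] -/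
theorem fderiv_coef_apply (i : Fin 3) {w : E3} (hw : w ∈ D.V₀) (v : E3) :
    fderiv ℝ (D.coef i) w v =
      D.α (D.Ψ₀ w) (fderiv ℝ (fderiv ℝ D.Ψ₀) w v (e i)) +
        fderiv ℝ D.α (D.Ψ₀ w) (fderiv ℝ D.Ψ₀ w v) (D.P i w) := by
  have hαΨ : HasFDerivAt (fun w => D.α (D.Ψ₀ w)) ((fderiv ℝ D.α (D.Ψ₀ w)).comp (fderiv ℝ D.Ψ₀ w)) w := by
    have hα : HasFDerivAt D.α (fderiv ℝ D.α (D.Ψ₀ w)) (D.Ψ₀ w) :=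
      ((D.α_smooth.contDiffAt (D.isOpen_U.mem_nhds (D.Ψ₀_mem_U hw))).differentiableAt
        (by simp)).hasFDerivAt
    exact hα.comp w (D.differentiableAt_Ψ₀ hw).hasFDerivAt
  have hP : HasFDerivAt (D.P i) ((fderiv ℝ (fderiv ℝ D.Ψ₀) w).flip (e i)) w := by
    have h1 : HasFDerivAt (fderiv ℝ D.Ψ₀) (fderiv ℝ (fderiv ℝ D.Ψ₀) w) w :=
      ((D.contDiffAt_fderiv_Ψ₀ hw).differentiableAt (by simp)).hasFDerivAt
    have h2 := h1.clm_apply (hasFDerivAt_const (e i) w)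
    rw [ContinuousLinearMap.comp_zero, zero_add] at h2
    exact h2
  have h := hαΨ.clm_apply hP
  rw [show (fun w => D.α (D.Ψ₀ w) (D.P i w)) = D.coef i from rfl] at h
  rw [h.fderiv]
  simp [ContinuousLinearMap.flip_apply, add_comm]

/-- **`∂_y A(0) = -α₀(r₀) dα₀(ċ(s₀), u₀)`** (from `B = 0`, the symmetry of second derivatives
of `Ψ₀`, and `dα = ` antisymmetrised `Dα`). [folklore] -/
theorem fderiv_coef_zero_e1 : fderiv ℝ (D.coef 0) 0 (e 1) = -(D.α 0 D.r₀ * dα D.α 0 D.c' D.u₀) := by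
  -- `∂ₓ B (0) = 0` since `B = 0` near `0`
  have hB : fderiv ℝ (D.coef 1) 0 (e 0) = 0 := by
    have hev : D.coef 1 =ᶠ[𝓝 0] fun _ => (0 : ℝ) :=
      Filter.eventually_of_mem D.V₀_mem_nhds_zero fun w hw => D.coef_one hw
    rw [hev.fderiv_eq]; simp
  have hsymm : IsSymmSndFDerivAt ℝ D.Ψ₀ 0 :=
    (D.contDiffAt_Ψ₀ D.zero_mem_V₀).isSymmSndFDerivAt
      (by rw [minSmoothness_of_isRCLikeNormedField]; exact WithTop.coe_le_coe.2 le_top)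
  rw [D.fderiv_coef_apply 1 D.zero_mem_V₀] at hB
  rw [D.fderiv_coef_apply 0 D.zero_mem_V₀, hsymm (e 1) (e 0)]
  have e0 : fderiv ℝ D.Ψ₀ 0 (e 0) = D.c' := D.P_zero_zero
  have e1 : fderiv ℝ D.Ψ₀ 0 (e 1) = D.Y 0 := D.P_one_zero
  rw [Ψ₀_zero, P_one_zero, e0, D.Y_zero, map_smul, smul_eq_mul] at hB
  rw [Ψ₀_zero, P_zero_zero, e1, D.Y_zero, map_smul, smul_apply, smul_eq_mul]
  simp only [dα]
  linear_combination hB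


/-! ### The graph function `a = -A/C` and the second coordinate change `Ψ₁ = (x, a, z)` -/

/-- The graph function `a = -A/C`: `Ψ₀^*α = C (dz - a dx)`. [folklore] -/
def a (w : E3) : ℝ := -(D.coef 0 w / D.coef 2 w)

/-- The set where `C ≠ 0` inside the good set. [folklore] -/
def V₁ : Set E3 := D.V₀ ∩ (D.coef 2) ⁻¹' {t | 0 < t}

/-- `V₁` is open. [folklore] -/
theorem isOpen_V₁ : IsOpen D.V₁ :=
  (ContinuousOn.isOpen_inter_preimage (fun _ hw => (D.contDiffAt_coef 2 hw).continuousAt.continuousWithinAt)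
    D.isOpen_V₀ isOpen_Ioi)

/-- `0 ∈ V₁`. [folklore] -/
theorem zero_mem_V₁ : (0 : E3) ∈ D.V₁ := ⟨D.zero_mem_V₀, D.coef_two_zero_pos⟩

/-- `V₁` is a neighbourhood of `0`. [folklore] -/
theorem V₁_mem_nhds_zero : D.V₁ ∈ 𝓝 (0 : E3) := D.isOpen_V₁.mem_nhds D.zero_mem_V₁

/-- `C > 0` on `V₁`. [folklore] -/
theorem coef_two_pos {w : E3} (hw : w ∈ D.V₁) : 0 < D.coef 2 w := hw.2

/-- `a` is smooth on `V₁`. [folklore] -/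
theorem contDiffAt_a {w : E3} (hw : w ∈ D.V₁) : ContDiffAt ℝ ∞ D.a w :=
  ((D.contDiffAt_coef 0 hw.1).div (D.contDiffAt_coef 2 hw.1) (D.coef_two_pos hw).ne').neg

/-- `a` is differentiable on `V₁`. [folklore] -/
theorem differentiableAt_a {w : E3} (hw : w ∈ D.V₁) : DifferentiableAt ℝ D.a w :=
  (D.contDiffAt_a hw).differentiableAt (by simp)

/-- `a(0) = 0`. [folklore] -/
@[simp] theorem a_zero : D.a 0 = 0 := by simp [a]

/-- `a = 0` on the axis. [folklore] -/
theorem a_axis {x : ℝ} (hx : (x • e 0 : E3) ∈ D.V₀) : D.a (x • e 0) = 0 := by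
  simp [a, D.coef_zero_axis hx]

/-- `A = -a C`. [folklore] -/
theorem coef_zero_eq {w : E3} (hw : w ∈ D.V₁) : D.coef 0 w = -(D.a w * D.coef 2 w) := by
  rw [a, neg_mul, neg_neg, div_mul_cancel₀ _ (D.coef_two_pos hw).ne']

/-- **`∂_y a(0) = dα₀(ċ(s₀), u₀) > 0`** (the contact condition). [folklore] -/
theorem fderiv_a_zero_e1 : fderiv ℝ D.a 0 (e 1) = dα D.α 0 D.c' D.u₀ := by
  set γ : ℝ → E3 := fun t => t • e 1 with hγ
  have hγd : HasDerivAt γ (e 1) 0 := by simpa [hγ] using (hasDerivAt_id (0:ℝ)).smul_const (e 1)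
  have hγ0 : γ 0 = 0 := by simp [hγ]
  have h1 : HasDerivAt (D.a ∘ γ) (fderiv ℝ D.a 0 (e 1)) 0 := by
    have hd : HasFDerivAt D.a (fderiv ℝ D.a 0) (γ 0) := by
      rw [hγ0]; exact (D.differentiableAt_a D.zero_mem_V₁).hasFDerivAt
    exact hd.comp_hasDerivAt 0 hγd
  -- the two coefficients along the line
  have hA : HasDerivAt (D.coef 0 ∘ γ) (fderiv ℝ (D.coef 0) 0 (e 1)) 0 := by
    have hd : HasFDerivAt (D.coef 0) (fderiv ℝ (D.coef 0) 0) (γ 0) := by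
      rw [hγ0]; exact (D.differentiableAt_coef 0 D.zero_mem_V₀).hasFDerivAt
    exact hd.comp_hasDerivAt 0 hγd
  have hC : HasDerivAt (D.coef 2 ∘ γ) (fderiv ℝ (D.coef 2) 0 (e 1)) 0 := by
    have hd : HasFDerivAt (D.coef 2) (fderiv ℝ (D.coef 2) 0) (γ 0) := by
      rw [hγ0]; exact (D.differentiableAt_coef 2 D.zero_mem_V₀).hasFDerivAt
    exact hd.comp_hasDerivAt 0 hγd
  have hC0 : (D.coef 2 ∘ γ) 0 ≠ 0 := by
    simp only [Function.comp, hγ0]; exact D.coef_two_zero_pos.ne'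
  have h2 := (hA.div hC hC0).neg
  have heq : -(D.coef 0 ∘ γ / (D.coef 2 ∘ γ)) = D.a ∘ γ := by
    funext t; simp [a, Function.comp]
  rw [heq] at h2
  have h3 := h1.unique h2
  rw [h3, D.fderiv_coef_zero_e1]
  simp only [Function.comp, hγ0, coef_zero_zero, zero_mul, sub_zero, coef_two_zero]
  have hr := D.α_r₀.ne'
  field_simp

/-- `∂_y a(0) > 0`. [folklore] -/
theorem fderiv_a_zero_e1_pos : 0 < fderiv ℝ D.a 0 (e 1) := by
  rw [fderiv_a_zero_e1]; exact D.twist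

/-! ### Shears `(v₀, v₁, v₂) ↦ (v₀, ℓ v, v₂)` -/

/-- The shear `v ↦ (v₀, ℓ v, v₂)` (the derivative of `Ψ₁`). [folklore] -/
def shear (ℓ : E3 →L[ℝ] ℝ) : E3 →L[ℝ] E3 :=
  (EuclideanSpace.proj (0 : Fin 3)).smulRight (e 0) + ℓ.smulRight (e 1) +
    (EuclideanSpace.proj (2 : Fin 3)).smulRight (e 2)

/-- The inverse shear. [folklore] -/
def shearInv (ℓ : E3 →L[ℝ] ℝ) : E3 →L[ℝ] E3 :=
  (EuclideanSpace.proj (0 : Fin 3)).smulRight (e 0) +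
    ((ℓ (e 1))⁻¹ • ((EuclideanSpace.proj (1 : Fin 3) : E3 →L[ℝ] ℝ) - (ℓ (e 0)) • EuclideanSpace.proj (0 : Fin 3) -
      (ℓ (e 2)) • EuclideanSpace.proj (2 : Fin 3))).smulRight (e 1) +
    (EuclideanSpace.proj (2 : Fin 3)).smulRight (e 2)

/-- Coordinates of the shear. [folklore] -/
@[simp] theorem shear_apply_zero (ℓ : E3 →L[ℝ] ℝ) (v : E3) : shear ℓ v 0 = v 0 := by
  simp [shear, e_apply]

/-- Coordinates of the shear. [folklore] -/
@[simp] theorem shear_apply_one (ℓ : E3 →L[ℝ] ℝ) (v : E3) : shear ℓ v 1 = ℓ v := by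
  simp [shear, e_apply]

/-- Coordinates of the shear. [folklore] -/
@[simp] theorem shear_apply_two (ℓ : E3 →L[ℝ] ℝ) (v : E3) : shear ℓ v 2 = v 2 := by
  simp [shear, e_apply]

/-- Coordinates of the inverse shear. [folklore] -/
@[simp] theorem shearInv_apply_zero (ℓ : E3 →L[ℝ] ℝ) (v : E3) : shearInv ℓ v 0 = v 0 := by
  simp [shearInv, e_apply]

/-- Coordinates of the inverse shear. [folklore] -/
@[simp] theorem shearInv_apply_one (ℓ : E3 →L[ℝ] ℝ) (v : E3) :
    shearInv ℓ v 1 = (ℓ (e 1))⁻¹ * (v 1 - ℓ (e 0) * v 0 - ℓ (e 2) * v 2) := by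
  simp [shearInv, e_apply]

/-- Coordinates of the inverse shear. [folklore] -/
@[simp] theorem shearInv_apply_two (ℓ : E3 →L[ℝ] ℝ) (v : E3) : shearInv ℓ v 2 = v 2 := by
  simp [shearInv, e_apply]

/-- The shear as a continuous linear equivalence, when `ℓ(e₁) ≠ 0`. [folklore] -/
def shearEquiv (ℓ : E3 →L[ℝ] ℝ) (h : ℓ (e 1) ≠ 0) : E3 ≃L[ℝ] E3 :=
  ContinuousLinearEquiv.equivOfInverse (shear ℓ) (shearInv ℓ)
    (fun v => euclidean_three_ext (by simp) (by
      rw [shearInv_apply_one, shear_apply_one, shear_apply_zero, shear_apply_two, clm_apply_eq ℓ v]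
      field_simp; simp [smul_eq_mul]; ring) (by simp))
    (fun u => euclidean_three_ext (by simp) (by
      rw [shear_apply_one, clm_apply_eq ℓ (shearInv ℓ u), shearInv_apply_zero, shearInv_apply_one,
        shearInv_apply_two]
      simp only [smul_eq_mul]
      field_simp
      ring) (by simp))

/-- The shear equivalence is the shear. [folklore] -/
@[simp] theorem shearEquiv_apply (ℓ : E3 →L[ℝ] ℝ) (h : ℓ (e 1) ≠ 0) (v : E3) : shearEquiv ℓ h v = shear ℓ v := rfl

/-- The inverse of the shear equivalence is the inverse shear. [folklore] -/
@[simp] theorem shearEquiv_symm_apply (ℓ : E3 →L[ℝ] ℝ) (h : ℓ (e 1) ≠ 0) (v : E3) :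
    (shearEquiv ℓ h).symm v = shearInv ℓ v := rfl

/-- The shear equivalence is the shear (as continuous linear maps). [folklore] -/
theorem coe_shearEquiv (ℓ : E3 →L[ℝ] ℝ) (h : ℓ (e 1) ≠ 0) : (shearEquiv ℓ h : E3 →L[ℝ] E3) = shear ℓ := by
  ext v; rfl

/-! ### `Ψ₁ = (x, a, z)` and its local inverse -/

/-- **The second coordinate change** `Ψ₁(x, y, z) = (x, a(x, y, z), z)`. [folklore] -/
def Ψ₁ (w : E3) : E3 := !₂[w 0, D.a w, w 2]

/-- Coordinates of `Ψ₁`. [folklore] -/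
@[simp] theorem Ψ₁_apply_zero (w : E3) : D.Ψ₁ w 0 = w 0 := by simp [Ψ₁]
/-- Coordinates of `Ψ₁`. [folklore] -/
@[simp] theorem Ψ₁_apply_one (w : E3) : D.Ψ₁ w 1 = D.a w := by simp [Ψ₁]
/-- Coordinates of `Ψ₁`. [folklore] -/
@[simp] theorem Ψ₁_apply_two (w : E3) : D.Ψ₁ w 2 = w 2 := by simp [Ψ₁]

/-- `Ψ₁(0) = 0`. [folklore] -/
@[simp] theorem Ψ₁_zero : D.Ψ₁ 0 = 0 := euclidean_three_ext (by simp) (by simp) (by simp)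

/-- `Ψ₁` fixes the axis. [folklore] -/
theorem Ψ₁_axis {x : ℝ} (hx : (x • e 0 : E3) ∈ D.V₀) : D.Ψ₁ (x • e 0) = x • e 0 :=
  euclidean_three_ext (by simp) (by simp [D.a_axis hx, e_apply]) (by simp)

/-- The derivative of `Ψ₁` is the shear by `Da`. [folklore] -/
theorem hasFDerivAt_Ψ₁ {w : E3} (hw : w ∈ D.V₁) : HasFDerivAt D.Ψ₁ (shear (fderiv ℝ D.a w)) w := by
  have key : HasFDerivAt (fun w : E3 => (![w 0, D.a w, w 2] : Fin 3 → ℝ))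
      (ContinuousLinearMap.pi ![(EuclideanSpace.proj (0 : Fin 3) : E3 →L[ℝ] ℝ), fderiv ℝ D.a w,
        EuclideanSpace.proj (2 : Fin 3)]) w := by
    rw [hasFDerivAt_pi']
    intro i; fin_cases i
    · simpa using (EuclideanSpace.proj (𝕜 := ℝ) (0 : Fin 3)).hasFDerivAt
    · simpa using (D.differentiableAt_a hw).hasFDerivAt
    · simpa using (EuclideanSpace.proj (𝕜 := ℝ) (2 : Fin 3)).hasFDerivAt
  have h := (EuclideanSpace.equiv (Fin 3) ℝ).symm.hasFDerivAt.comp w key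
  have heq : ((EuclideanSpace.equiv (Fin 3) ℝ).symm : (Fin 3 → ℝ) →L[ℝ] E3).comp
      (ContinuousLinearMap.pi ![(EuclideanSpace.proj (0 : Fin 3) : E3 →L[ℝ] ℝ), fderiv ℝ D.a w,
        EuclideanSpace.proj (2 : Fin 3)]) = shear (fderiv ℝ D.a w) := by
    ext v i; fin_cases i <;> simp [shear, e_apply]
  rw [heq] at h
  exact h

/-- `Ψ₁` is smooth on `V₁`. [folklore] -/
theorem contDiffAt_Ψ₁ {w : E3} (hw : w ∈ D.V₁) : ContDiffAt ℝ ∞ D.Ψ₁ w := by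
  have h : ContDiffAt ℝ ∞ (fun w : E3 => (![w 0, D.a w, w 2] : Fin 3 → ℝ)) w := by
    rw [contDiffAt_pi]
    intro i; fin_cases i
    · simpa using (EuclideanSpace.proj (𝕜 := ℝ) (0 : Fin 3)).contDiff.contDiffAt
    · simpa using D.contDiffAt_a hw
    · simpa using (EuclideanSpace.proj (𝕜 := ℝ) (2 : Fin 3)).contDiff.contDiffAt
  exact (EuclideanSpace.equiv (Fin 3) ℝ).symm.contDiff.contDiffAt.comp w h

/-- The derivative of `Ψ₁` at `0` is the shear equivalence. [folklore] -/
theorem hasFDerivAt_Ψ₁_zero :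
    HasFDerivAt D.Ψ₁ (shearEquiv (fderiv ℝ D.a 0) D.fderiv_a_zero_e1_pos.ne' : E3 →L[ℝ] E3) 0 := by
  rw [coe_shearEquiv]; exact D.hasFDerivAt_Ψ₁ D.zero_mem_V₁

/-- **`Ψ₁` is a local diffeomorphism at the origin** (inverse function theorem; `∂_y a(0) ≠ 0`).
[folklore] -/
def Φ₁ : OpenPartialHomeomorph E3 E3 :=
  ContDiffAt.toOpenPartialHomeomorph D.Ψ₁ (D.contDiffAt_Ψ₁ D.zero_mem_V₁) D.hasFDerivAt_Ψ₁_zero (by simp)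

/-- `Φ₁` is `Ψ₁` as a function. [folklore] -/
theorem Φ₁_coe : (D.Φ₁ : E3 → E3) = D.Ψ₁ := ContDiffAt.toOpenPartialHomeomorph_coe _ _ _

/-- `0` lies in the source of `Φ₁`. [folklore] -/
theorem zero_mem_Φ₁_source : (0 : E3) ∈ D.Φ₁.source :=
  ContDiffAt.mem_toOpenPartialHomeomorph_source _ _ _

/-- `0` lies in the target of `Φ₁`. [folklore] -/
theorem zero_mem_Φ₁_target : (0 : E3) ∈ D.Φ₁.target := by
  have := ContDiffAt.image_mem_toOpenPartialHomeomorph_target (D.contDiffAt_Ψ₁ D.zero_mem_V₁)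
    D.hasFDerivAt_Ψ₁_zero (by simp)
  rwa [Ψ₁_zero] at this

/-- `Φ₁⁻¹(0) = 0`. [folklore] -/
@[simp] theorem Φ₁_symm_zero : D.Φ₁.symm 0 = 0 := by
  have := D.Φ₁.left_inv D.zero_mem_Φ₁_source
  rwa [Φ₁_coe, Ψ₁_zero] at this


/-! ### The Darboux box `Ψ = Ψ₀ ∘ Ψ₁⁻¹` -/

/-- `Da` is smooth on `V₁`. [folklore] -/
theorem contDiffAt_fderiv_a {w : E3} (hw : w ∈ D.V₁) : ContDiffAt ℝ ∞ (fderiv ℝ D.a) w :=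
  (D.contDiffAt_a hw).fderiv_right (m := ∞) (by simp)

/-- The core set: good parameters at which both coordinate changes are local diffeomorphisms with
invertible derivatives and `C > 0`. [folklore] -/
def Vc : Set E3 :=
  (D.V₁ ∩ (fun w => fderiv ℝ D.a w (e 1)) ⁻¹' {t | t ≠ 0}) ∩
    (D.V₀ ∩ (fderiv ℝ D.Ψ₀) ⁻¹' range (ContinuousLinearEquiv.toContinuousLinearMap : (E3 ≃L[ℝ] E3) → _)) ∩
    D.Φ₀.source ∩ D.Φ₁.source

/-- The core set is open. [folklore] -/
theorem isOpen_Vc : IsOpen D.Vc := by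
  refine ((IsOpen.inter ?_ ?_).inter D.Φ₀.open_source).inter D.Φ₁.open_source
  · exact ContinuousOn.isOpen_inter_preimage
      (fun w hw => ((D.contDiffAt_fderiv_a hw).clm_apply contDiffAt_const).continuousAt.continuousWithinAt)
      D.isOpen_V₁ isOpen_ne
  · exact ContinuousOn.isOpen_inter_preimage
      (fun w hw => (D.contDiffAt_fderiv_Ψ₀ hw).continuousAt.continuousWithinAt) D.isOpen_V₀
      ContinuousLinearEquiv.isOpen

/-- `0` lies in the core set. [folklore] -/
theorem zero_mem_Vc : (0 : E3) ∈ D.Vc := by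
  refine ⟨⟨⟨⟨D.zero_mem_V₁, D.fderiv_a_zero_e1_pos.ne'⟩, ⟨D.zero_mem_V₀, ?_⟩⟩, D.zero_mem_Φ₀_source⟩,
    D.zero_mem_Φ₁_source⟩
  show fderiv ℝ D.Ψ₀ 0 ∈ range _
  rw [D.fderiv_Ψ₀_zero, ← coe_frameEquiv]
  exact mem_range_self _

/-- The core set lies in `V₁`. [folklore] -/
theorem Vc_subset_V₁ : D.Vc ⊆ D.V₁ := fun _ hw => hw.1.1.1.1
/-- The core set lies in the good set. [folklore] -/
theorem Vc_subset_V₀ : D.Vc ⊆ D.V₀ := fun _ hw => hw.1.1.2.1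

/-- **The domain of the Darboux box.** [folklore] -/
def V : Set E3 := D.Φ₁.target ∩ D.Φ₁.symm ⁻¹' D.Vc

/-- The domain of the Darboux box is open. [folklore] -/
theorem isOpen_V : IsOpen D.V := D.Φ₁.isOpen_inter_preimage_symm D.isOpen_Vc

/-- `0` lies in the domain of the Darboux box. [folklore] -/
theorem zero_mem_V : (0 : E3) ∈ D.V := ⟨D.zero_mem_Φ₁_target, by
  show D.Φ₁.symm 0 ∈ D.Vc; rw [Φ₁_symm_zero]; exact D.zero_mem_Vc⟩

/-- The domain of the Darboux box is a neighbourhood of `0`. [folklore] -/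
theorem V_mem_nhds_zero : D.V ∈ 𝓝 (0 : E3) := D.isOpen_V.mem_nhds D.zero_mem_V

/-- **The Darboux box** `Ψ = Ψ₀ ∘ Ψ₁⁻¹`. [folklore] -/
def Ψ (w : E3) : E3 := D.Ψ₀ (D.Φ₁.symm w)

/-- **The conformal factor** `g = C ∘ Ψ₁⁻¹`: `Ψ^*α = g (dz - y dx)`. [folklore] -/
def g (w : E3) : ℝ := D.coef 2 (D.Φ₁.symm w)

section PointOfV

variable {D} {w : E3} (hw : w ∈ D.V)
include hw

/-- `Ψ₁⁻¹` maps `V` into the core set. [folklore] -/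
theorem symm_mem_Vc : D.Φ₁.symm w ∈ D.Vc := hw.2

/-- `Ψ₁ ∘ Ψ₁⁻¹ = id` on `V`. [folklore] -/
theorem Ψ₁_symm : D.Ψ₁ (D.Φ₁.symm w) = w := by
  rw [← Φ₁_coe]; exact D.Φ₁.right_inv hw.1

/-- `a ∘ Ψ₁⁻¹` is the second coordinate. [folklore] -/
theorem a_symm : D.a (D.Φ₁.symm w) = w 1 := by
  have := congrArg (fun v : E3 => v 1) (Ψ₁_symm hw)
  simpa using this

/-- `∂_y a ≠ 0` at `Ψ₁⁻¹ w`. [folklore] -/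
theorem fderiv_a_symm_ne : fderiv ℝ D.a (D.Φ₁.symm w) (e 1) ≠ 0 := (symm_mem_Vc hw).1.1.1.2

/-- The derivative of `Φ₁` at `Ψ₁⁻¹ w` is a shear equivalence. [folklore] -/
theorem hasFDerivAt_Φ₁_at_symm :
    HasFDerivAt D.Φ₁ (shearEquiv (fderiv ℝ D.a (D.Φ₁.symm w)) (fderiv_a_symm_ne hw) : E3 →L[ℝ] E3)
      (D.Φ₁.symm w) := by
  rw [coe_shearEquiv, Φ₁_coe]
  exact D.hasFDerivAt_Ψ₁ (D.Vc_subset_V₁ (symm_mem_Vc hw))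

/-- The derivative of `Ψ₁⁻¹` at `w` is the inverse shear. [folklore] -/
theorem hasFDerivAt_Φ₁_symm :
    HasFDerivAt D.Φ₁.symm
      ((shearEquiv (fderiv ℝ D.a (D.Φ₁.symm w)) (fderiv_a_symm_ne hw)).symm : E3 →L[ℝ] E3) w :=
  D.Φ₁.hasFDerivAt_symm hw.1 (hasFDerivAt_Φ₁_at_symm hw)

/-- `Ψ₁⁻¹` is smooth on `V`. [folklore] -/
theorem contDiffAt_Φ₁_symm : ContDiffAt ℝ ∞ D.Φ₁.symm w :=
  D.Φ₁.contDiffAt_symm hw.1 (hasFDerivAt_Φ₁_at_symm hw) (by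
    rw [Φ₁_coe]; exact D.contDiffAt_Ψ₁ (D.Vc_subset_V₁ (symm_mem_Vc hw)))

/-- `Ψ` is smooth on `V`. [folklore] -/
theorem contDiffAt_Ψ : ContDiffAt ℝ ∞ D.Ψ w :=
  (D.contDiffAt_Ψ₀ (D.Vc_subset_V₀ (symm_mem_Vc hw))).comp w (contDiffAt_Φ₁_symm hw)

/-- `g` is smooth on `V`. [folklore] -/
theorem contDiffAt_g : ContDiffAt ℝ ∞ D.g w :=
  (D.contDiffAt_coef 2 (D.Vc_subset_V₀ (symm_mem_Vc hw))).comp w (contDiffAt_Φ₁_symm hw)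

/-- `g > 0` on `V`. [folklore] -/
theorem g_pos : 0 < D.g w := D.coef_two_pos (D.Vc_subset_V₁ (symm_mem_Vc hw))

/-- `Ψ(V) ⊆ U`. [folklore] -/
theorem Ψ_mem_U : D.Ψ w ∈ D.U := D.Ψ₀_mem_U (D.Vc_subset_V₀ (symm_mem_Vc hw))

/-- The chain rule for `Ψ`. [folklore] -/
theorem hasFDerivAt_Ψ :
    HasFDerivAt D.Ψ ((fderiv ℝ D.Ψ₀ (D.Φ₁.symm w)).comp
      (shearInv (fderiv ℝ D.a (D.Φ₁.symm w)))) w := by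
  have h := (D.differentiableAt_Ψ₀ (D.Vc_subset_V₀ (symm_mem_Vc hw))).hasFDerivAt.comp w
    (hasFDerivAt_Φ₁_symm hw)
  exact h

/-- The derivative of `Ψ`, evaluated. [folklore] -/
theorem fderiv_Ψ_apply (v : E3) :
    fderiv ℝ D.Ψ w v = fderiv ℝ D.Ψ₀ (D.Φ₁.symm w) (shearInv (fderiv ℝ D.a (D.Φ₁.symm w)) v) := by
  rw [(hasFDerivAt_Ψ hw).fderiv]; rfl

/-- The derivative of `Ψ` is injective on `V`. [folklore] -/
theorem fderiv_Ψ_injective : Injective (fderiv ℝ D.Ψ w) := by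
  rw [(hasFDerivAt_Ψ hw).fderiv]
  obtain ⟨L, hL⟩ := (symm_mem_Vc hw).1.1.2.2
  intro u v huv
  simp only [ContinuousLinearMap.comp_apply] at huv
  rw [← hL] at huv
  have h1 := L.injective huv
  have h2 := congrArg (shear (fderiv ℝ D.a (D.Φ₁.symm w))) h1
  have key : ∀ x : E3, shear (fderiv ℝ D.a (D.Φ₁.symm w)) (shearInv (fderiv ℝ D.a (D.Φ₁.symm w)) x) = x :=
    fun x => by
      have := (shearEquiv (fderiv ℝ D.a (D.Φ₁.symm w)) (fderiv_a_symm_ne hw)).apply_symm_apply x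
      simpa using this
  rwa [key, key] at h2

end PointOfV

/-- Expansion of `α(DΨ₀ u)` in the coefficients `A, B, C`. [folklore] -/
theorem α_fderiv_Ψ₀ (w' u : E3) :
    D.α (D.Ψ₀ w') (fderiv ℝ D.Ψ₀ w' u) = u 0 * D.coef 0 w' + u 1 * D.coef 1 w' + u 2 * D.coef 2 w' := by
  rw [clm_apply_eq (fderiv ℝ D.Ψ₀ w') u]
  simp only [map_add, map_smul, smul_eq_mul, coef, P]

/-- **The Darboux normal form**: `α_{Ψ w}(DΨ_w v) = g(w) (v₂ - w₁ v₀)`, i.e. `Ψ^*α = g (dz - y dx)`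
on `V`. [folklore] -/
theorem α_Ψ_fderiv {w : E3} (hw : w ∈ D.V) (v : E3) :
    D.α (D.Ψ w) (fderiv ℝ D.Ψ w v) = D.g w * (v 2 - w 1 * v 0) := by
  have hw' := symm_mem_Vc hw
  rw [fderiv_Ψ_apply hw, Ψ, α_fderiv_Ψ₀, D.coef_one (D.Vc_subset_V₀ hw'),
    D.coef_zero_eq (D.Vc_subset_V₁ hw'), a_symm hw, shearInv_apply_zero, shearInv_apply_two, g]
  ring

/-- `Ψ` is injective on `V`. [folklore] -/
theorem injOn_Ψ : InjOn D.Ψ D.V := by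
  intro w₁ h₁ w₂ h₂ h
  have h' : D.Φ₁.symm w₁ = D.Φ₁.symm w₂ :=
    D.injOn_Ψ₀ (symm_mem_Vc h₁).1.2 (symm_mem_Vc h₂).1.2 h
  rw [← D.Φ₁.right_inv h₁.1, ← D.Φ₁.right_inv h₂.1, h']

/-- On the axis, `Ψ` is the curve: `Ψ(x, 0, 0) = c(s₀ + x)` (for axis points of `V` whose
parameter also lies in the good set and the source of `Ψ₁⁻¹`). [folklore] -/
theorem Ψ_axis {x : ℝ} (hx : (x • e 0 : E3) ∈ D.V₀) (hxs : (x • e 0 : E3) ∈ D.Φ₁.source) :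
    D.Ψ (x • e 0) = D.c (D.s₀ + x) := by
  have h1 : D.Φ₁.symm (x • e 0) = x • e 0 := by
    have := D.Φ₁.left_inv hxs
    rwa [Φ₁_coe, D.Ψ₁_axis hx] at this
  rw [Ψ, h1, D.Ψ₀_axis hx]

/-- **The velocity along the axis**: `DΨ_{(x,0,0)} e₀ = ċ(s₀ + x)`. [folklore] -/
theorem fderiv_Ψ_e0_axis {x : ℝ} (hxV : (x • e 0 : E3) ∈ D.V) (hx0 : (x • e 0 : E3) ∈ D.V₀)
    (hxs : (x • e 0 : E3) ∈ D.Φ₁.source) :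
    fderiv ℝ D.Ψ (x • e 0) (e 0) = deriv D.c (D.s₀ + x) := by
  -- differentiate `t ↦ Ψ (t e₀) = c (s₀ + t)` near `x`
  set γ : ℝ → E3 := fun t => t • e 0 with hγ
  have hγd : HasDerivAt γ (e 0) x := by simpa [hγ] using (hasDerivAt_id x).smul_const (e 0)
  have hdiff : DifferentiableAt ℝ D.Ψ (x • e 0) := (contDiffAt_Ψ hxV).differentiableAt (by simp)
  have h1 : HasDerivAt (D.Ψ ∘ γ) (fderiv ℝ D.Ψ (x • e 0) (e 0)) x :=
    hdiff.hasFDerivAt.comp_hasDerivAt x hγd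
  have hc : Continuous fun t : ℝ => (t • e 0 : E3) := continuous_id.smul continuous_const
  have hmem : ∀ᶠ t in 𝓝 x, (t • e 0 : E3) ∈ D.V₀ ∩ D.Φ₁.source :=
    hc.continuousAt.preimage_mem_nhds ((D.isOpen_V₀.inter D.Φ₁.open_source).mem_nhds ⟨hx0, hxs⟩)
  have hev : (fun t => D.c (D.s₀ + t)) =ᶠ[𝓝 x] (D.Ψ ∘ γ) := by
    filter_upwards [hmem] with t ht
    exact (D.Ψ_axis ht.1 ht.2).symm
  have hx' : D.s₀ + x ∈ Ioo (D.s₀ - D.δ) (D.s₀ + D.δ) := by simpa [e_apply] using hx0.2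
  have h2 : HasDerivAt (fun t => D.c (D.s₀ + t)) (deriv D.c (D.s₀ + x)) x := by
    have h3 : HasDerivAt (fun t => D.c (D.s₀ + t)) ((1 : ℝ) • deriv D.c (D.s₀ + x)) x :=
      HasDerivAt.scomp (g₁ := D.c) (h := fun t => D.s₀ + t) x (D.hasDerivAt_c hx')
        ((hasDerivAt_id' x).const_add D.s₀)
    rwa [one_smul] at h3
  exact (h1.congr_of_eventuallyEq hev).unique h2


/-! ### The derivative of the normal form: `Ψ^* dα = d(g (dz - y dx))` -/

/-- The 1-form of a field of functionals. [folklore] -/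
def form1 (β : E3 → E3 →L[ℝ] ℝ) (w : E3) : E3 [⋀^Fin 1]→L[ℝ] ℝ :=
  ContinuousAlternatingMap.ofSubsingleton ℝ E3 ℝ (0 : Fin 1) (β w)

/-- The 1-form of a field of functionals, evaluated. [folklore] -/
@[simp] theorem form1_apply (β : E3 → E3 →L[ℝ] ℝ) (w : E3) (v : Fin 1 → E3) : form1 β w v = β w (v 0) := rfl

/-- The 1-form of a field of functionals through Mathlib's linear isometry `ofSubsingletonLIE`. [folklore] -/
theorem form1_eq (β : E3 → E3 →L[ℝ] ℝ) :
    form1 β = fun w => ContinuousAlternatingMap.ofSubsingletonLIE (𝕜 := ℝ) (E := E3) (F := ℝ)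
      (ι := Fin 1) 0 (β w) := rfl

/-- The 1-form of a differentiable field of functionals is differentiable. [folklore] -/
theorem differentiableAt_form1 {β : E3 → E3 →L[ℝ] ℝ} {w : E3} (h : DifferentiableAt ℝ β w) :
    DifferentiableAt ℝ (form1 β) w := by
  rw [form1_eq]
  exact (ContinuousAlternatingMap.ofSubsingletonLIE (𝕜 := ℝ) (E := E3) (F := ℝ) (ι := Fin 1)
    0).toContinuousLinearEquiv.differentiableAt.comp w h

/-- **`d` of a 1-form on `ℝ³`** in Mathlib's normalisation is the antisymmetrised derivative `dα`.
[folklore] -/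
theorem extDeriv_form1_apply {β : E3 → E3 →L[ℝ] ℝ} {w : E3} (h : DifferentiableAt ℝ β w) (u v : E3) :
    extDeriv (form1 β) w ![u, v] = dα β w u v := by
  rw [extDeriv_apply (differentiableAt_form1 h)]
  simp only [form1_apply, dα]
  have h1 : ∀ a b : E3, fderiv ℝ (fun x => β x a) w b = fderiv ℝ β w b a := fun a b => by
    rw [fderiv_clm_apply h (differentiableAt_const a)]
    simp
  simp [Fin.removeNth, h1]
  ring

/-- The model form `θ_w = g(w) (dz - w₁ dx)` as a field of functionals. [folklore] -/
def modelForm (w : E3) : E3 →L[ℝ] ℝ :=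
  D.g w • ((EuclideanSpace.proj (2 : Fin 3) : E3 →L[ℝ] ℝ) - (w 1) • EuclideanSpace.proj (0 : Fin 3))

/-- The model form, evaluated: `g(w) (v₂ - w₁ v₀)`. [folklore] -/
@[simp] theorem modelForm_apply (w v : E3) : D.modelForm w v = D.g w * (v 2 - w 1 * v 0) := by
  simp [modelForm, smul_eq_mul]

/-- The pulled-back form `(Ψ^*α)_w = α_{Ψ w} ∘ DΨ_w`. [folklore] -/
def pullForm (w : E3) : E3 →L[ℝ] ℝ := (D.α (D.Ψ w)).comp (fderiv ℝ D.Ψ w)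

/-- On `V` the pulled-back form is the model form. [folklore] -/
theorem pullForm_eq {w : E3} (hw : w ∈ D.V) : D.pullForm w = D.modelForm w := by
  ext v; simp [pullForm, D.α_Ψ_fderiv hw]

/-- `g` is differentiable on `V`. [folklore] -/
theorem differentiableAt_g {w : E3} (hw : w ∈ D.V) : DifferentiableAt ℝ D.g w :=
  (contDiffAt_g hw).differentiableAt (by simp)

/-- The derivative of the coefficients of the model form. [folklore] -/
theorem fderiv_modelForm_apply {w : E3} (hw : w ∈ D.V) (a b : E3) :
    fderiv ℝ (fun x => D.modelForm x a) w b =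
      (a 2 - w 1 * a 0) * fderiv ℝ D.g w b - D.g w * a 0 * b 1 := by
  have hg : HasFDerivAt D.g (fderiv ℝ D.g w) w := (D.differentiableAt_g hw).hasFDerivAt
  have hp : HasFDerivAt (fun x : E3 => x 1) (EuclideanSpace.proj (1 : Fin 3) : E3 →L[ℝ] ℝ) w :=
    (EuclideanSpace.proj (𝕜 := ℝ) (1 : Fin 3)).hasFDerivAt
  have hl := (hp.mul_const (a 0)).const_sub (a 2)
  have h := hg.mul hl
  have heq : (fun x => D.modelForm x a) = D.g * fun x : E3 => a 2 - x 1 * a 0 := by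
    funext x; simp [Pi.mul_apply]
  rw [heq, h.fderiv]
  simp [smul_eq_mul]
  ring

/-- The model form is differentiable on `V`. [folklore] -/
theorem differentiableAt_modelForm {w : E3} (hw : w ∈ D.V) : DifferentiableAt ℝ D.modelForm w := by
  have h1 : DifferentiableAt ℝ (fun x : E3 => (x 1) • (EuclideanSpace.proj (0 : Fin 3) : E3 →L[ℝ] ℝ)) w :=
    (EuclideanSpace.proj (𝕜 := ℝ) (1 : Fin 3)).differentiableAt.smul (differentiableAt_const _)
  have h2 : DifferentiableAt ℝ (fun x : E3 => (EuclideanSpace.proj (2 : Fin 3) : E3 →L[ℝ] ℝ) -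
      (x 1) • (EuclideanSpace.proj (0 : Fin 3) : E3 →L[ℝ] ℝ)) w := (differentiableAt_const _).sub h1
  exact (D.differentiableAt_g hw).smul h2

/-- `d` of the model form: `d(g (dz - y dx))(u, v) = g (u₀ v₁ - u₁ v₀) + Dg(u) θ(v) - Dg(v) θ(u)`.
[folklore] -/
theorem dα_modelForm {w : E3} (hw : w ∈ D.V) (u v : E3) :
    dα D.modelForm w u v =
      D.g w * (u 0 * v 1 - u 1 * v 0) + fderiv ℝ D.g w u * (v 2 - w 1 * v 0) -
        fderiv ℝ D.g w v * (u 2 - w 1 * u 0) := by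
  have key : ∀ a b : E3, fderiv ℝ D.modelForm w b a = (a 2 - w 1 * a 0) * fderiv ℝ D.g w b - D.g w * a 0 * b 1 :=
    fun a b => by
      rw [← D.fderiv_modelForm_apply hw a b, fderiv_clm_apply (D.differentiableAt_modelForm hw)
        (differentiableAt_const a)]
      simp
  simp only [dα, key]
  ring

/-- **`Ψ^* dα = d(Ψ^* α)` evaluated**: the antisymmetrised derivative of `α` at `Ψ w` on pushed
forward vectors is that of the model form `g (dz - y dx)` (naturality of `d`, Mathlib's
`extDeriv_pullback`). [folklore] -/
theorem dα_Ψ_fderiv {w : E3} (hw : w ∈ D.V) (u v : E3) :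
    dα D.α (D.Ψ w) (fderiv ℝ D.Ψ w u) (fderiv ℝ D.Ψ w v) =
      D.g w * (u 0 * v 1 - u 1 * v 0) + fderiv ℝ D.g w u * (v 2 - w 1 * v 0) -
        fderiv ℝ D.g w v * (u 2 - w 1 * u 0) := by
  have hαd : DifferentiableAt ℝ D.α (D.Ψ w) :=
    (D.α_smooth.contDiffAt (D.isOpen_U.mem_nhds (Ψ_mem_U hw))).differentiableAt (by simp)
  -- naturality of `d`
  have hnat := @extDeriv_pullback ℝ E3 E3 ℝ _ _ _ _ _ _ _ 1 ∞ w (form1 D.α) D.Ψ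
    (differentiableAt_form1 hαd) (contDiffAt_Ψ hw)
    (by rw [minSmoothness_of_isRCLikeNormedField]; exact WithTop.coe_le_coe.2 le_top)
  -- the pulled-back 1-form is `form1 pullForm`, which agrees with `form1 modelForm` near `w`
  have h1 : (fun x => (form1 D.α (D.Ψ x)).compContinuousLinearMap (fderiv ℝ D.Ψ x)) =
      form1 D.pullForm := by
    funext x; ext y; simp [form1, pullForm]
  have h2 : form1 D.pullForm =ᶠ[𝓝 w] form1 D.modelForm := by
    filter_upwards [D.isOpen_V.mem_nhds hw] with x hx
    simp only [form1, D.pullForm_eq hx]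
  rw [h1, h2.extDeriv_eq] at hnat
  have h3 := congrArg (fun L => L ![u, v]) hnat
  simp only [ContinuousAlternatingMap.compContinuousLinearMap_apply] at h3
  have h4 : (⇑(fderiv ℝ D.Ψ w) ∘ ![u, v]) = ![fderiv ℝ D.Ψ w u, fderiv ℝ D.Ψ w v] := by
    funext i; fin_cases i <;> rfl
  rw [h4, extDeriv_form1_apply (D.differentiableAt_modelForm hw), extDeriv_form1_apply hαd,
    D.dα_modelForm hw] at h3
  exact h3.symm


/-! ### Boxes around the origin and the packaged output -/

/-- The open box of half-width `ℓ` around the origin. [folklore] -/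
def box (ℓ : ℝ) : Set E3 := {w | ∀ i, |w i| < ℓ}

/-- The basis vectors are unit vectors. [folklore] -/
theorem norm_e (i : Fin 3) : ‖(e i : E3)‖ = 1 := by
  simp [e]

/-- The Euclidean norm is at most the `ℓ¹`-norm of the coordinates. [folklore] -/
theorem norm_le_sum_abs (w : E3) : ‖w‖ ≤ |w 0| + |w 1| + |w 2| := by
  conv_lhs => rw [eq_sum_smul_e w]
  refine (norm_add_le _ _).trans (add_le_add ((norm_add_le _ _).trans (add_le_add ?_ ?_)) ?_) <;>
    rw [norm_smul, norm_e, mul_one, Real.norm_eq_abs]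

/-- A box of half-width `ℓ` lies in the ball of radius `3ℓ`. [folklore] -/
theorem box_subset_ball {ℓ : ℝ} : box ℓ ⊆ ball (0 : E3) (3 * ℓ) := fun w hw => by
  rw [mem_ball_zero_iff]
  have := norm_le_sum_abs w
  linarith [hw 0, hw 1, hw 2]

/-- Every neighbourhood of the origin contains a box. [folklore] -/
theorem exists_box_subset {s : Set E3} (hs : s ∈ 𝓝 (0 : E3)) : ∃ ℓ > 0, box ℓ ⊆ s := by
  obtain ⟨r, hr, hrs⟩ := Metric.mem_nhds_iff.1 hs
  refine ⟨r / 3, by positivity, fun w hw => hrs (?_)⟩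
  have := box_subset_ball hw
  rwa [show 3 * (r / 3) = r by ring] at this

/-- Axis points with `|x| < ℓ` lie in the box. [folklore] -/
theorem smul_e_mem_box {ℓ x : ℝ} (hx : |x| < ℓ) (hℓ : 0 < ℓ) (i : Fin 3) : (x • e i : E3) ∈ box ℓ := by
  intro j
  rw [PiLp.smul_apply, e_apply, smul_eq_mul]
  split_ifs <;> simp [hx, hℓ]

/-- **The Darboux box, packaged**: a half-width `ℓ > 0` such that the box lies in the domain `V`
of the Darboux box `Ψ` and its axis segment in the sets where `Ψ(x, 0, 0) = c(s₀ + x)` and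
`DΨ e₀ = ċ` hold. [folklore] -/
theorem exists_box : ∃ ℓ > 0, box ℓ ⊆ D.V ∧
    ∀ x : ℝ, |x| < ℓ → (x • e 0 : E3) ∈ D.V ∧ (x • e 0 : E3) ∈ D.V₀ ∧ (x • e 0 : E3) ∈ D.Φ₁.source := by
  obtain ⟨ℓ, hℓ, hsub⟩ := exists_box_subset (Filter.inter_mem D.V_mem_nhds_zero
    (Filter.inter_mem D.V₀_mem_nhds_zero (D.Φ₁.open_source.mem_nhds D.zero_mem_Φ₁_source)))
  refine ⟨ℓ, hℓ, fun w hw => (hsub hw).1, fun x hx => ?_⟩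
  have h := hsub (smul_e_mem_box hx hℓ 0)
  exact ⟨h.1, h.2.1, h.2.2⟩

end DarbouxData

end Literature.Geometry.Symplectic.LegendrianDarboux

end
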